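import Summits.CriticalPhenomena.Ising3DConformalLimit.Theorems.ArmHyperscalingOneArmHyperscalingReduction
import Summits.CriticalPhenomena.Ising3DConformalLimit.Theorems.OneArmHyperscaling.Negative.KSliceAndExponentLadder
import HarnessLib

/-!
# `OneArmHyperscaling` (stmt-CriticalPhenomena-15591) is EQUIVALENT to one-arm hyperscaling of the face-conditioned
magnetisation (line `mirror-face-saturation`; lead prover-line-stmt-CriticalPhenomena-15591-0, 2026-08-17)

The line bounds the crux's `m⁺_{Kn}` by the face-conditioned magnetisation `F = faceMag K n = ⟨σ_x | θA ≡ +⟩_{β_c}`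
(`faceSubadditivity_proof`: `0 ≤ m⁺_{Kn} ≤ 6F`).  Conversely `F ≤ m⁺_{Kn}`: conditioning on ONE exterior face of the
box `x + Λ_{Kn}` being plus magnetises the centre less than conditioning on all six (volume antitonicity of plus
expectations, GKS/FKG), `faceMag_le_plusBoxMag`.  Hence (`oneArmHyperscaling_iff_face`, registered glue sub-goal)

  `OneArmHyperscaling ↔ ∃ K ≥ 2, ∃ C, ∀ n ≥ 1, (faceMag K n)² ≤ C · ⟨σ₀σ_{2ne₀}⟩_{β_c}`

(`K ≥ 1 ⟹ K ≥ 2` by the disprover's landed slice monotonicity `oneArmHyperscalingAt_mono`).  So the WEAKEST core of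
the line is the crux itself in one-face dress; the two landed SUFFICIENT one-scale cores are strictly stronger:
`FaceSaturation` (via mirror Cauchy–Schwarz, `OneArmHyperscaling_of_faceSaturation`) and `CasimirBound` (via RP with
the indicator test vector, `OneArmHyperscaling_of_casimir`).
-/

noncomputable section

namespace Summit.CriticalPhenomena.Ising3DConformalLimit.Cruxes.OneArmHyperscaling.MirrorFaceSaturation

open Literature.Probability.LatticeModels Finset Filter
open Summit.CriticalPhenomena.Ising3DConformalLimit.OneArmHyperscalingNegative (oneArmHyperscalingAt_mono)

/-- **One plus face magnetises the centre less than six**: `faceMag K n ≤ plusBoxMag K n` for all `K, n`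
(finite volume: `⟨σ_x⟩⁺_{Λ_L ∖ facePatch} ≤ ⟨σ_x⟩⁺_{Λ_L ∖ ⋃ faces} = m⁺_{Kn}` by volume antitonicity
`isingCorr_plus_le_of_subset` and `stub_boxMagMarkov`; then `L → ∞` with `stub_faceLimit`, `stub_faceSymmetry`). -/
theorem faceMag_le_plusBoxMag (K n : ℕ) : faceMag K n ≤ plusBoxMag K n := by
  have hlim := stub_faceLimit K n (faceShift n 0)
  refine le_of_tendsto hlim (eventually_atTop.2 ⟨K * n + n + 1, fun L hL => ?_⟩)
  obtain ⟨hxΛ, hxE, _hEΛ, _hdisj⟩ := stub_faceGeometry K n L hL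
  rw [← stub_faceSymmetry K n L 0, stub_boxMagMarkov K n L hL]
  -- volume antitonicity between `Λ_L ∖ ⋃ faces ⊆ Λ_L ∖ face 0`
  have hsub : box 3 L \ Finset.univ.biUnion (face K n) ⊆ box 3 L \ face K n 0 :=
    sdiff_subset_sdiff Subset.rfl (subset_biUnion_of_mem (face K n) (mem_univ (0 : Fin 6)))
  have hxin : evalSite n ∈ box 3 L \ Finset.univ.biUnion (face K n) := by
    rw [Finset.mem_sdiff, Finset.mem_biUnion]
    exact ⟨hxΛ, fun ⟨i, _, hi⟩ => hxE i hi⟩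
  have hs : spinProduct ({evalSite n} : Finset (Site 3)) = spinAt (evalSite n) := by
    funext s; simp [spinProduct]
  have h := isingCorr_plus_le_of_subset (zdGraph 3) (criticalBeta_nonneg 3) le_rfl
    (Finset.singleton_subset_iff.2 hxin) hsub
  unfold frozenMag
  rwa [isingCorr, isingCorr, hs] at h

/-- **The crux is one-arm hyperscaling of the face-conditioned magnetisation** (registered glue sub-goal):
`OneArmHyperscaling ↔ ∃ K ≥ 2, ∃ C, ∀ n ≥ 1, (faceMag K n)² ≤ C ⟨σ₀σ_{2ne₀}⟩`. -/
theorem oneArmHyperscaling_iff_face :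
    Summit.CriticalPhenomena.Ising3DConformalLimit.Theses.ArmHyperscaling.OneArmHyperscaling ↔
      ∃ K : ℕ, 2 ≤ K ∧ ∃ C : ℝ, ∀ n : ℕ, 1 ≤ n →
        faceMag K n ^ 2 ≤ C * criticalTwoPoint 3 (Pi.single 0 (2 * (n : ℤ))) := by
  constructor
  · rintro ⟨K, hK, C, hC⟩
    -- move to the ratio `max K 2 ≥ 2` by slice monotonicity, then `F ≤ m⁺`
    refine ⟨max K 2, le_max_right _ _, C, fun n hn => ?_⟩
    have hmono := oneArmHyperscalingAt_mono (le_max_left K 2) hC n hn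
    have hF0 : 0 ≤ faceMag (max K 2) n := by
      obtain ⟨hm0, hm⟩ := faceSubadditivity_proof (max K 2) n (le_max_right _ _) hn
      linarith
    exact le_trans (pow_le_pow_left₀ hF0 (faceMag_le_plusBoxMag _ _) 2) hmono
  · rintro ⟨K, hK, C, hC⟩
    refine ⟨K, by omega, 36 * C, fun n hn => ?_⟩
    obtain ⟨hm0, hm⟩ := faceSubadditivity_proof K n hK hn
    have hF := hC n hn
    calc plusBoxMag K n ^ 2 ≤ (6 * faceMag K n) ^ 2 := pow_le_pow_left₀ hm0 hm 2
      _ = 36 * faceMag K n ^ 2 := by ring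
      _ ≤ 36 * (C * criticalTwoPoint 3 (Pi.single 0 (2 * (n : ℤ)))) := by linarith
      _ = 36 * C * criticalTwoPoint 3 (Pi.single 0 (2 * (n : ℤ))) := by ring

end Summit.CriticalPhenomena.Ising3DConformalLimit.Cruxes.OneArmHyperscaling.MirrorFaceSaturation

end
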